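import Summits.QuantumFields.YangMills.Theorems.BalabanUVNodesN12FlatChartDerivIterLin
import Literature.MathematicalPhysics.QuantumFieldTheory.Balaban1983to89.Node00.MultiScaleFibreChartB
import HarnessLib

/-!
# BalabanUVNodes ∕ N12 — THE (J-b) JUNCTION, NODE-00 HALF: AT THE FLAT BACKGROUND THE DERIVATIVE OF NODE 00's MULTI-SCALE AVERAGING CHART IS THE — **BOND-DATUM EDITION** (`…N12FlatChartDerivIterLinB`, USED DECLARATIONS ONLY)

The print-datum ([Balaban1984PropagatorsII] (2.3)) (γ) twin of `Summits/…/Theorems/BalabanUVNodesN12FlatChartDerivIterLin.lean`: the declarations of the parent whose STATEMENT reads the determining datum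
(`agreeOn_avgFamily_one`, `fderiv_msChart_one_apply_eq_iterLin`, `rightInverse_iff_iterLin_reproduces`, `iterLin_eq_of_rightInverse`) and which N12's junction of record v14ᴸ uses (dag-n12-c g35 probe-2 census `UsedConstsN12RoadTyped2`, THEOREMS block), re-typed over a
BOND-LEVEL datum `𝔅 : BDetSet` (F0a `B15DeterminingSetsB`) and dag-n12-c's bond-datum chart `Node00.msChartB` (✓p774329; `msChart 𝐁 = msChartB (bondsDet 𝐁)` by `rfl`).  GENERATOR twin
(this seat's `work/g32/gen_thm.py`, block-extracted from the parent's tree bytes): namespace `…N12FlatChartDerivIterLinB`, SAME short names, `DetSet ↦ BDetSet`, `AgreeOn 𝐁 ↦ AgreeOnB 𝔅`,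
`IsMinimizer ↦ IsMinimizerB`, `bondsOf (𝐁 j) ↦ 𝔅 j`, `msChart ∕ constrCard ∕ constrEnum ∕ ConstrSet ↦ …B`, NODE 00 chart lemmas `…msChart… ↦ …msChartB…`; proofs VERBATIM; the parent's
datum-free declarations REUSED BY NAME (`open`), never copied (private plumbing excepted, №366 R2).  The parent's (b) statements are the instances `𝔅 := bondsDet 𝐁`.

Cell `pub-ymgap` (HUMAN RULINGS D-0062 ∕ D-0149), seat `pub-ymgap-dag-n12-d` g32 (R134 N12 [B15] s2; the (ii) Theorems-side re-key of N12's road at print's [II] (2.3) datum — director-ym №338 ∕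
№343 (E1)(iii-b), FLAG №16 ∕ ruling (α); dag-n12-c DESIGN memo a793b2ebc0b803bf (ii); `N12-ROAD-TWIN-ORDER-2026-08-30.md`).  Count-neutral helper of K1⁹ `stmt-QuantumFields-27364`,
`--kind proof --supports … --as helper`.  THEOREMS ONLY (0 `def`, 0 `instance`, 0 `sorry`).

HONEST FRAMING (director-ym №338 (5)).  PURELY ADDITIVE: the parent stays landed and true on its own text; nothing in it is edited; no displayed premise of any consumer is deleted or
weakened; every hypothesis of the parent stays a hypothesis.  Nothing of Bałaban's analysis asserted; N12 NOT discharged; K0⁷ ∕ K1⁹ NOT closed; counts unmoved (typed 28∕28 · discharged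
8∕27, A 8∕28; K 1∕4); one finite 𝕋⁴ programme at fixed ε — R4 closes the conditional rung `BalabanLadder.UV` only; NOT the Yang–Mills mass gap (Clay); nothing continuum ∕ ℝ⁴ ∕ OS.

PARENT's DOCSTRING (the mathematics and the citations; read the site-level `𝐁` as the bond datum `𝔅`):
# BalabanUVNodes ∕ N12 — THE (J-b) JUNCTION, NODE-00 HALF: AT THE FLAT BACKGROUND THE DERIVATIVE OF NODE 00's MULTI-SCALE AVERAGING CHART IS THE
# `linAvg`-RECURSION `Q^{(j)}` — the velocity of `t ↦ Ū^j(1·exp(tX))(c)` is `(Q^{(j)}X)(c)`, hence `(DΦ(0)X)_{(j,c)} = π((Q^{(j)}X)(c))` for n07-w2's canonical chart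
# `Φ = msChart … 1` at the flat datum, so that dag-n12-w3's `hLH : DΨ(0)(H y) = y` READS «the linearised k-fold averages of `H y` reproduce `y` on the constrained bonds»

Cell `pub-ymgap` (HUMAN RULINGS D-0062 ∕ D-0149), width seat `pub-ymgap-dag-n10-w1` g0, plan g80 WORDS-1b CANDIDATE № 10 = START-LIST §n12 (J-b); module B of the cut announced on the
bus (l.25856; n12-c NO-OBJECTION l.≈25906); module A = `Thm/BalabanUVNodesN12FlatConstraintPlaquetteJunction` (p592369 ✓: the V1 plaquette half).  Key K1⁷ `stmt-QuantumFields-20542`,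
`--kind proof --supports … --as helper`; count-neutral; THEOREMS ONLY (0 `def`, 0 `sorry`, 0 `instance`).  CONSUMED BY NAME, nothing modified: the route UnitScaleTilt's QUANTITATIVE flat
linearisation `Prop7AvgLinearisation.norm_iter_sub_one_sub_iterLin_le` ([Balaban1985Averaging] Prop. 3 (122)–(125) iterated: `Ū^k(U) = 1 + Q^{(k)}(U − 1) + O(δ²)` on `SU`-valued
fields `δ`-close to `1`), its letters `linAvg_sub`, `norm_linAvg_le`, `Prop8Chart.linAvg_const_smul`; n07-e's `Node00.hasDerivAt_coe_expChart_along` ∕ `hasDerivAt_ray` (`D exp(0) = id`); n07-w2's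
`Node00.fderiv_msChart_apply_of_hasDerivAt` (the chart's derivative in velocity currency); `B15Claim189UnitTestAtRecord.iter_avOfRecord_one` ∕ `avgFamily_avOfRecord_one`,
`T3DescentFibreTower.small_one` (the flat datum is on the guard).

THE PRINT.  [Balaban1985Variational] Sect. C (44)–(48) p. 285 (the LINEARISED averaging `Q` of the variational problem and its right inverse `H`: (45) «L^jηQ_jHB = B on Λ_j»);
[Balaban1985Averaging] Prop. 3 (121)–(125) p. 36 («the Taylor expansion of Q(V₀, A, c) begins with a first-order polynomial L(Q(V₀)A)_c»); [Balaban1987RG1] (0.4) p. 253, (0.21) p. 256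
(the k-fold average).  PRECEDENT IN THE TREE (not transported): `UnitScaleTiltProp8ChartDeriv.fderiv_chartLog_zero_apply` proves the same sentence for the route UnitScaleTilt's
UNGUARDED `𝔸ˣ`-valued average in the complex chart `e^{iηA}`; THIS file proves it for NODE 00's GUARDED `SU(N)` averaging of record in n07-e's real chart `expChart`, by the
elementary route «quantitative remainder `O(δ²)` + `exp(tX) − 1 − tX = o(t)` ⇒ derivative».

CONTENTS.
§1 (private plumbing) letters of the recursion family `Q` (`Q 0 Y = Y`, `Q (i+1) Y = linAvg (Q i Y)`): additivity, ℝ-homogeneity, the crude sup bound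
   `‖Q k Z c‖ ≤ (3ℓ)^k·M` (`ℓ = (d+2)L`) — public twins: `FLContraction.iterLin_sub`, `LinearAvgMatrix.norm_iterLin_le`.
§2 `hasDerivAt_coe_expChart_one_smul`, `coe_expChart_one_zero_smul` (bond letters), ★★ `hasDerivAt_coe_iter_expChart_one_smul` — on ANY torus `P`, for the family `blockAvg expMeanLogSU` of (0.4): `HasDerivAt (t ↦ ↑(Ū^k(1·exp(tX))(c))) ((Q^{(k)}↑X)(c)) 0`.
§3 AT NODE 00's OBJECTS (`avOfRecord F N K = fun _ => blockAvg expMeanLogSU`, `rfl`): `hasDerivAt_coe_avgFamily_expChart_one_smul`, `smallBelow_avOfRecord_one`, ★★★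
   `fderiv_msChart_one_apply_eq_iterLin` — for EVERY level-bounded determining set `𝔹` and the flat datum `W := M˙(1) = 1`:
   `fderiv ℝ (msChart F N K k 𝔹 1 1) 0 X i = suProj N ((Q^{(j)}↑X)(c))` at the constrained bond `i ↔ (j, c)`; ★★ `rightInverse_iff_iterLin_reproduces` — a map `H` is a right inverse
   of `DΦ(0)` (dag-n12-w3's `hLH`) IFF `suProj N ((Q^{(j)}↑(H y))(c)) = y i` on every constrained bond (the k-fold linearised averages of `H y` reproduce `y` on `𝔹`); §1½
   `walkSum_mem_lieSU` ∕ `linAvg_mem_lieSU` ∕ `iterLin_mem_lieSU` (`Q^{(k)}` preserves `𝔰𝔲(N)`-valued fields) and ★★ `iterLin_eq_of_rightInverse` (the matrix-level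
   reproduction `(Q^{(j)}↑(H y))(c) = ↑(y_{(j,c)})`, no projection — module A's input).

HONEST FRAMING.  Real calculus + bookkeeping on the tree's own objects at the FLAT background only (`U₀ = 1`, the base point of [LF-II]'s `H⁰_{1,k}`); the recursion letter `Q` is
DISPLAYED (inhabited: `ChartHInv.exists_linFamily`); nothing of Bałaban's estimates asserted; the identification at curved backgrounds (the `W_j(c)*` twist and `U ≠ 1`) is NOT here;
N12 NOT discharged; count-neutral (typed 28∕28 · discharged 5∕27 unmoved); one finite 𝕋⁴ programme at fixed ε — R4 closes the conditional rung `BalabanLadder.UV` only; the YM mass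
gap (Clay) is NOT proved by any of this.  No `sorry`, no `def`, no `instance`, no `notation`.
-/

noncomputable section

open scoped BigOperators Matrix.Norms.L2Operator Topology
open Filter Asymptotics Finset

namespace Summit.QuantumFields.YangMills.BalabanUVNodes.N12FlatChartDerivIterLinB

open Literature.MathematicalPhysics.QuantumFieldTheory.Balaban1983to89.B15DeterminingSetsB

open Literature.MathematicalPhysics.QuantumFieldTheory.Balaban1983to89
open T4Continuum (T4Family)
open BlockAveraging (blockAvg)
open ExpMeanLog (expMeanLogSU deltaSU deltaSU_pos)
open BlockAveragingEMLLinearised (linAvg)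
open T4AdjointCovarianceUnitary (lieSU expSU)
open B15DeterminingSets
open Node00
open Summit.QuantumFields.YangMills.Theorems.Prop7AvgLinearisation (norm_iter_sub_one_sub_iterLin_le norm_linAvg_le linAvg_sub)
open Summit.QuantumFields.YangMills.Theorems.Prop8Chart (linAvg_const_smul)
open Summit.QuantumFields.YangMills.BalabanUVNodes.N12FlatChartDerivIterLin (hasDerivAt_coe_avgFamily_expChart_one_smul iterLin_mem_lieSU smallBelow_avOfRecord_one)

section
variable {F : T4Family} {N : ℕ} [NeZero N] {K k : ℕ}

/-- The flat datum `W := M˙(1)` agrees with itself on every determining set (the `hU` binder of the chart theorems at `U = 1`). [cite: Balaban1988Convergent, (2.11) p.256 (bookkeeping)] -/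
theorem agreeOn_avgFamily_one (𝔅 : BDetSet (F.P K)) :
    AgreeOnB 𝔅 (avgFamily (avOfRecord F N K) (1 : GaugeField (F.P K) 0 (SU N))) (avgFamily (avOfRecord F N K) (1 : GaugeField (F.P K) 0 (SU N))) :=
  fun _ _ _ => rfl

end

section
variable {F : T4Family} {N : ℕ} [NeZero N] {K k : ℕ}

/-- ★★★ **THE DERIVATIVE OF THE FLAT MULTI-SCALE CHART IS `π ∘ Q^{(j)}`.**  For every level-bounded determining set `𝔅` (constrained bonds of levels `≤ k`, enumerated by
`constrEnumB 𝔅 k`), at the flat configuration `U = 1` with its own flat datum `W = M˙(1)`: the derivative at `0` of n07-w2's canonical chart `Φ = msChartB F N K k 𝔅 W 1` applied to a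
direction `X : bonds → 𝔰𝔲(N)` has, at the constrained bond `i ↔ (j, c)`, the component `π((Q^{(j)}↑X)(c))` (`π = suProj N`, the identity on `𝔰𝔲(N)`; `W_j(c) = 1` untwists) — i.e.
`DΦ(0) = π ∘ Q^{(·)}` restricted to `𝔅`: the LINEARISED MULTI-SCALE (0.4)-CONSTRAINT of [Balaban1985Variational] (44)–(48) IS the `linAvg`-recursion.
[cite: Balaban1985Variational, (44)-(48) p.285; Balaban1985Averaging, Prop. 3 (121)-(125) p.36; Balaban1987RG1, (0.21) p.256] -/
theorem fderiv_msChart_one_apply_eq_iterLin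
    (Q : (i : ℕ) → (PBond (F.P K) 0 → Matrix (Fin N) (Fin N) ℂ) → PBond (F.P K) i → Matrix (Fin N) (Fin N) ℂ)
    (hQ0 : ∀ Y, Q 0 Y = Y) (hQs : ∀ (i : ℕ) (Y : PBond (F.P K) 0 → Matrix (Fin N) (Fin N) ℂ) (c : PBond (F.P K) (i + 1)), Q (i + 1) Y c = linAvg (Q i Y) c)
    (𝔅 : BDetSet (F.P K)) (X : PBond (F.P K) 0 → lieSU (Fin N)) (i : Fin (constrCardB 𝔅 k)) :
    fderiv ℝ (msChartB F N K k 𝔅 (avgFamily (avOfRecord F N K) (1 : GaugeField (F.P K) 0 (SU N))) (1 : GaugeField (F.P K) 0 (SU N))) 0 X i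
      = suProj N (Q ((constrEnumB 𝔅 k).symm i).1 (fun b => (X b : Matrix (Fin N) (Fin N) ℂ)) ((constrEnumB 𝔅 k).symm i).2.1) := by
  have h := fderiv_msChartB_apply_of_hasDerivAt (F := F) (N := N) (K := K) (k := k) (𝔅 := 𝔅) (agreeOn_avgFamily_one 𝔅) smallBelow_avOfRecord_one X i
    (hasDerivAt_coe_avgFamily_expChart_one_smul Q hQ0 hQs X _ _)
  have hW : star ((avgFamily (avOfRecord F N K) (1 : GaugeField (F.P K) 0 (SU N)) ((constrEnumB 𝔅 k).symm i).1 ((constrEnumB 𝔅 k).symm i).2.1 : SU N) :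
      Matrix (Fin N) (Fin N) ℂ) = 1 := by
    rw [B15Claim189UnitTestAtRecord.avgFamily_avOfRecord_one]
    exact star_one _
  rw [hW, one_mul] at h
  exact h

end

section
variable {F : T4Family} {N : ℕ} [NeZero N] {K k : ℕ}

/-- ★★ **WHAT `DΨ(0) ∘ H = id` SAYS** (dag-n12-w3's binder `hLH : ∀ y, fderiv ℝ Ψ 0 (H y) = y` of `B11Eq177CriticalFamilyDerivative.fderiv_flatCriticalExpChartFamily_eq` at `Ψ :=` the flat
multi-scale chart): a map `H` from chart values to fine Lie-algebra fields is a right inverse of `DΦ(0)` IFF on every constrained bond `(j, c)` of `𝔅` the `j`-fold LINEARISED average of `H y`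
reproduces the datum, `π((Q^{(j)}↑(H y))(c)) = y_{(j,c)}` — the sentence module A turns into the plaquette statement. [cite: Balaban1985Variational, (45) p.285, (174)/(177) pp.305-306] -/
theorem rightInverse_iff_iterLin_reproduces
    (Q : (i : ℕ) → (PBond (F.P K) 0 → Matrix (Fin N) (Fin N) ℂ) → PBond (F.P K) i → Matrix (Fin N) (Fin N) ℂ)
    (hQ0 : ∀ Y, Q 0 Y = Y) (hQs : ∀ (i : ℕ) (Y : PBond (F.P K) 0 → Matrix (Fin N) (Fin N) ℂ) (c : PBond (F.P K) (i + 1)), Q (i + 1) Y c = linAvg (Q i Y) c)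
    (𝔅 : BDetSet (F.P K)) (H : (Fin (constrCardB 𝔅 k) → lieSU (Fin N)) → PBond (F.P K) 0 → lieSU (Fin N)) :
    (∀ y, fderiv ℝ (msChartB F N K k 𝔅 (avgFamily (avOfRecord F N K) (1 : GaugeField (F.P K) 0 (SU N))) (1 : GaugeField (F.P K) 0 (SU N))) 0 (H y) = y) ↔
      ∀ (y : Fin (constrCardB 𝔅 k) → lieSU (Fin N)) (i : Fin (constrCardB 𝔅 k)),
        suProj N (Q ((constrEnumB 𝔅 k).symm i).1 (fun b => (H y b : Matrix (Fin N) (Fin N) ℂ)) ((constrEnumB 𝔅 k).symm i).2.1) = y i := by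
  constructor
  · intro h y i
    rw [← fderiv_msChart_one_apply_eq_iterLin Q hQ0 hQs 𝔅 (H y) i, h y]
  · intro h y
    funext i
    rw [fderiv_msChart_one_apply_eq_iterLin Q hQ0 hQs 𝔅 (H y) i, h y i]

end

section
variable {F : T4Family} {N : ℕ} [NeZero N] {K k : ℕ}

/-- ★★ **THE RIGHT INVERSE REPRODUCES THE DATUM AS MATRICES** (no projection): since `Q^{(j)}` of the `𝔰𝔲(N)`-valued field `H y` is `𝔰𝔲(N)`-valued, `π` is the identity on it, so a right
inverse `H` of `DΦ(0)` satisfies `(Q^{(j)}↑(H y))(c) = ↑(y_{(j,c)})` on every constrained bond — the matrix-level reproduction that module A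
(`N12FlatConstraintPlaquetteJunction.oc_iterLin_comp_eq_of_reproduce` ∕ `chainLaw_iterLin_comp_linearMap`) turns into the chain binders `hYk ∕ hY`. [cite: Balaban1985Variational, (45) p.285] -/
theorem iterLin_eq_of_rightInverse
    (Q : (i : ℕ) → (PBond (F.P K) 0 → Matrix (Fin N) (Fin N) ℂ) → PBond (F.P K) i → Matrix (Fin N) (Fin N) ℂ)
    (hQ0 : ∀ Y, Q 0 Y = Y) (hQs : ∀ (i : ℕ) (Y : PBond (F.P K) 0 → Matrix (Fin N) (Fin N) ℂ) (c : PBond (F.P K) (i + 1)), Q (i + 1) Y c = linAvg (Q i Y) c)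
    (𝔅 : BDetSet (F.P K)) (H : (Fin (constrCardB 𝔅 k) → lieSU (Fin N)) → PBond (F.P K) 0 → lieSU (Fin N))
    (hH : ∀ y, fderiv ℝ (msChartB F N K k 𝔅 (avgFamily (avOfRecord F N K) (1 : GaugeField (F.P K) 0 (SU N))) (1 : GaugeField (F.P K) 0 (SU N))) 0 (H y) = y)
    (y : Fin (constrCardB 𝔅 k) → lieSU (Fin N)) (i : Fin (constrCardB 𝔅 k)) :
    Q ((constrEnumB 𝔅 k).symm i).1 (fun b => (H y b : Matrix (Fin N) (Fin N) ℂ)) ((constrEnumB 𝔅 k).symm i).2.1 = (y i : Matrix (Fin N) (Fin N) ℂ) := by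
  have h := (rightInverse_iff_iterLin_reproduces Q hQ0 hQs 𝔅 H).1 hH y i
  have hmem : Q ((constrEnumB 𝔅 k).symm i).1 (fun b => (H y b : Matrix (Fin N) (Fin N) ℂ)) ((constrEnumB 𝔅 k).symm i).2.1 ∈ lieSU (Fin N) :=
    iterLin_mem_lieSU Q hQ0 hQs (fun b => (H y b).2) _ _
  rw [← h, coe_suProj_of_mem hmem]

end

end Summit.QuantumFields.YangMills.BalabanUVNodes.N12FlatChartDerivIterLinB

end
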